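import Summits.Ventures.PercRepro.C026K5
import Summits.Ventures.PercRepro.C017UpTo5

/-!
# `C026UpTo 5`: C-026 on every multigraph with at most five vertices, kernel-checked end to end (p5, gen 7)

C-026 (mine-3's M3-Q3, the Harris-matching upper bound): `P(a~b)·P(c ≁ a ∧ c ≁ b) ≤ P(exactly one
pair)` for every marked multigraph, every `p ∈ [0,1]^E`, every three marks.  `C026UpTo_of_simpleInj`
(`C026.lean`) reduces it on `≤ N` vertices to the class census over the SIMPLE graphs with `≤ N`
vertices and INJECTIVE 3-markings; typer-1's generic transfer (`C017UpTo5.lean`: every simple graph on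
five vertices is a spanning subgraph of `K₅`, every injective 3-marking is `0, 1, 2` after a
permutation of the vertices, `ClassPositiveSimpleInjUpTo_of_graphOf`) and `check26_k5`
(`C026K5.lean`) give:

* **`census26`** — `0 ≤ CS₂₆(graphOf B, m)` for every adjacency matrix `B` on five vertices and every
  injective `m`;
* **`classPositive26_5 : ClassPositiveSimpleInjUpTo 3 5 kernel26`** and **`c026UpTo5 : C026UpTo 5`**:
  C-026 on EVERY multigraph with at most five vertices, for every `p` and every marking — the three
  kernel slices of `C026K5.lean` plus the reduction chain, no computation outside the Lean kernel.
-/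

namespace PercRepro

namespace C026

open MultiGraph

/-- **The adjacency-matrix census on five vertices for `kernel26`**: `0 ≤ CS₂₆(graphOf B, m)` for every
matrix `B` and every injective 3-marking `m` — from the faces `[⊥, u]` of `K₅`. -/
theorem census26 (B : Fin 5 → Fin 5 → Bool) (m : Fin 3 → Fin 5) (hm : Function.Injective m) :
    0 ≤ (graphOf B).cubeSumQuad m kernel26 := by
  obtain ⟨π, hπ⟩ := C017.exists_perm_of_injective m hm
  rw [← (graphOf B).cubeSumQuad_mapVertices π.injective m kernel26]
  have hcomp : (⇑π ∘ m) = C017.m₀ := funext hπ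
  rw [hcomp, C017.cubeSumQuad_eq_graphOf_adjOf _
    ((graphOf B).isSimple_mapVertices π.injective (C017.isSimple_graphOf 5 B))]
  rw [show C017.m₀ = ![0, 1, 2] from rfl, cubeSumQuad_kernel26_eq_cubeSum26Z,
    (graphOf _).cubeSum26Z_eq_faceSlack26Z_sub Examples.k5 (C017.subOf_graphOf _) 0 1 2]
  exact_mod_cast Examples.k5.faceSlack26Z_nonneg_of_check 0 1 2 Examples.check26_k5 _

end C026

/-- **`kernel26` is class-positive on every simple graph with ≤ 5 vertices and every injective
3-marking** — kernel-checked (the three slices of `C026K5.lean`). -/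
theorem classPositive26_5 : ClassPositiveSimpleInjUpTo 3 5 kernel26 :=
  C017.ClassPositiveSimpleInjUpTo_of_graphOf 3 5 kernel26 C026.census26

/-- **C-026 on every multigraph with at most five vertices, every `p`, every marking** — kernel-checked
end to end: `P(a~b)·P(c ≁ a ∧ c ≁ b) ≤ P(ab|c) + P(ac|b) + P(bc|a)`. -/
theorem c026UpTo5 : C026UpTo 5 := C026UpTo_of_simpleInj classPositive26_5

end PercRepro
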